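import Literature.Probability.NegativeDependence.RayleighLogSubmodular
import Literature.Probability.NegativeDependence.ExchangeableStronglyRayleigh
import Literature.Probability.Distributions.LogConcaveSequences
import Literature.Combinatorics.LorentzianPolynomials.Bivariate
import HarnessLib

/-!
# Exchangeable measures: ULC ⟺ NLC ⟺ h-NLC ⟺ h-NLC+ ⟺ Rayleigh (Pemantle 2000, Thm. 2.7; Wagner 2008, Prop. 3.6)

R. Pemantle, *Towards a theory of negative dependence*, J. Math. Phys. 41 (2000) 1371–1390 (arXiv:math/0404095,
held `paper:arxiv-math_0404095`), §2.4. Verbatim: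

> If the random variables `{X_j}` are exchangeable, then `μ` is completely characterized by its rank sequence, with
> `μ{X_j = η(j) : 1 ≤ j ≤ n} = a_k / C(n,k)` for `k = Σ_j η(j)`. In this case, the negative lattice condition boils
> down to log-concavity of the sequence `{a_k / C(n,k)}` […]
> **Definition 2.6.** A finite sequence `{a_k : 0 ≤ k ≤ n}` is said to be Ultra-Log-Concave (ULC) if the nonzero
> terms of the sequence `{a_k / C(n,k)}` form a log-concave sequence and the indices of the nonzero terms form an
> interval.
> **Theorem 2.7.** Suppose that `{X_j}` are exchangeable. Then the six conditions CNA+, JNRD+, h-NLC+, CNA, JNRD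
> and h-NLC (see Figure 1) are equivalent to Ultra-Log-Concavity of the rank sequence `{a_k}`. This is trivially
> equivalent to the negative lattice condition.
> **Lemma 2.8.** Let `μ` be an exchangeable measure with ULC rank sequence. Suppose the measure `μ'` is obtained
> from `μ` by imposing an external field at coordinates `1,…,k` […] and then projecting onto coordinates
> `r+1,…,n` for some `r ≥ k`. Then `μ'` is exchangeable with ULC rank sequence. *Proof.* […] it suffices to
> consider the case `r = 1` […] `q_j' = C (q_j + λ q_{j+1})` […]
> `C^{-2}[(q_j')² - q_{j-1}' q_{j+1}'] = [q_j² - q_{j+1}q_{j-1}] + λ[q_j q_{j-1} - q_{j+1} q_{j-2}] + λ²[q_{j-1}² - q_j q_{j-2}]`.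
> *Proof of Theorem 2.7:* It is clear that ULC is equivalent to the negative lattice condition and hence is implied
> by h-NLC. […] if `μ` is exchangeable and ULC, then Lemma 2.8 shows that all projections of `μ` are as well, which
> means that the NLC holds hereditarily, giving h-NLC. In fact, the lemma is enough to give h-NLC+, since any `μ*`
> obtained from `μ` may be described (after re-ordering of coordinates) as some measure `μ'` as in the lemma, on
> which has been imposed an external field […]; this is invariant under external fields, so `μ*` satisfies [NLC].

D. G. Wagner, *Negatively correlated random variables and Mason's conjecture …*, Ann. Comb. 12 (2008), §3:
"**Proposition 3.6.** […] `Z(y) = a_0 e_0(y) + a_1 e_1(y) + ⋯ + a_m e_m(y)`, in which the `a_k` are nonnegative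
real numbers. The following are equivalent: (a) the polynomial `Z(y)` satisfies the Rayleigh condition; (b) the
sequence `(a_k : 0 ≤ k ≤ m)` is logarithmically concave with no internal zeros […]".

## What is here (the h-NLC / h-NLC+ / Rayleigh part of Thm. 2.7; CNA, JNRD are not treated)

An exchangeable weight is `μ(S) = q(|S|)` (tree `IsExchangeable`, `IsExchangeable.exists_eq_card`), and ULC of the
rank sequence `a_k = C(n,k) q(k)` in Pemantle's sense (log-concave nonzero terms on an interval of indices) is the
tree's `PF₂` predicate `IsLogConcaveSeq` for `q` (interval form `q(a)q(d) ≤ q(b)q(c)`, `a ≤ b ≤ d`, `a + d = b + c`;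
`LogConcaveSequences.lean`), see `isUltraLogConcave_rankSeq_card`.

* §1 `IsLogConcaveSeq.add_mul_succ` — Lemma 2.8's computation: `q_j + λ q_{j+1}` is again `PF₂` (`λ ≥ 0`).
* §2 "ULC is trivially equivalent to NLC": `isNLC_card_iff` / `IsExchangeable.isNLC_iff`.
* §3 Lemma 2.8 for a block of coordinates: the projection of `g_μ(a·z)` onto `S` is `T ↦ a^T Q(|T|)` with
  `Q(j) = Σ_{W ⊆ Sᶜ} a^W q(j + |W|)` (`projectOn_extField_card`), and `Q` is `PF₂` (`isLogConcaveSeq_fieldSum`).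
* §4 **Thm. 2.7 (h-NLC+)**: `isHNLCPlus_card` (ULC ⟹ h-NLC+), and with the tree's Prop. 2.2 / Thm. 4.4
  (`RayleighLogSubmodular.lean`): **`isRayleigh_card_iff`** (exchangeable: Rayleigh ⟺ ULC — Wagner Prop. 3.6
  (a)⟺(b)), `IsExchangeable.isRayleigh_iff`, `IsExchangeable.isHNLC_iff`, `IsExchangeable.isHNLCPlus_iff`.

## References

* [Pemantle2000] R. Pemantle, Towards a theory of negative dependence, J. Math. Phys. 41 (2000) 1371–1390 — §2.4
  Def. 2.6, Thm. 2.7, Lemma 2.8.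
* [Wagner2008] D. G. Wagner, Ann. Comb. 12 (2008) 211–239 — §3 Prop. 3.6 (a)⟺(b).
* [BorceaBrandenLiggett2007] J. Borcea, P. Brändén, T. M. Liggett, J. Amer. Math. Soc. 22 (2009) — §2.1 Def. 2.4,
  Prop. 2.2; §3 Thm. 3.7 ("Theorem 3.7 ([P])").
* [Karlin1968] S. Karlin, Total positivity, Ch. 8 §1 (`PF₂` sequences).
* [SempleWelsh2008] C. Semple, D. Welsh, Negative correlation in graphs and matroids, Combin. Probab. Comput. 17
  (2008) 423–435 — §2 Example 2.2 ("Uniform matroids are correlated").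
-/

noncomputable section

open Finset MvPolynomial
open Literature.Probability.Distributions
open Literature.Combinatorics.LorentzianPolynomials (IsUltraLogConcave)

namespace Literature.Probability.NegativeDependence

variable {σ : Type*} [Fintype σ] [DecidableEq σ]

/-! ## §1 Lemma 2.8's computation: `q + λ q(·+1)` stays `PF₂` -/

section Shift

/-- **Pemantle, Lemma 2.8 (the computation)**: if `q` is log-concave with no internal zeros (`PF₂`) and `λ ≥ 0`
then so is `q_j' = q_j + λ q_{j+1}` ("`[(q_j')² - q_{j-1}'q_{j+1}'] = [q_j² - q_{j+1}q_{j-1}] + λ[…] + λ²[…]`", here in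
the interval form). [cite: Pemantle2000, §2.4 Lemma 2.8 (proof)] -/
theorem IsLogConcaveSeq.add_mul_succ {q : ℕ → ℝ} (hq : IsLogConcaveSeq q) {l : ℝ} (hl : 0 ≤ l) :
    IsLogConcaveSeq fun j => q j + l * q (j + 1) := by
  refine ⟨fun n => add_nonneg (hq.1 n) (mul_nonneg hl (hq.1 _)), fun a b c d hab hbd h => ?_⟩
  dsimp only
  rcases hbd.lt_or_eq with hbd' | rfl
  · have h1 : q a * q d ≤ q b * q c := hq.2 hab hbd h
    have h2 : q (a + 1) * q (d + 1) ≤ q (b + 1) * q (c + 1) := hq.2 (by omega) (by omega) (by omega)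
    have h3 : q a * q (d + 1) ≤ q b * q (c + 1) := hq.2 hab (by omega) (by omega)
    have h4 : q (a + 1) * q d ≤ q (b + 1) * q c := hq.2 (by omega) (by omega) (by omega)
    nlinarith [mul_nonneg hl (sub_nonneg.2 h3), mul_nonneg hl (sub_nonneg.2 h4),
      mul_nonneg (mul_nonneg hl hl) (sub_nonneg.2 h2)]
  · have hc : c = a := by omega
    subst hc
    exact le_of_eq (by ring)

end Shift

/-! ## §2 "ULC is trivially equivalent to the negative lattice condition" -/

section NLC

omit [Fintype σ] in
/-- ULC ⟹ NLC for `μ(S) = q(|S|)`: `q(|S ∪ T|) q(|S ∩ T|) ≤ q(|S|) q(|T|)` is the interval inequality of `PF₂`.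
[cite: Pemantle2000, §2.4 (before Def. 2.6) and proof of Thm. 2.7 ("ULC is equivalent to the negative lattice
condition")] -/
theorem isNLC_card {q : ℕ → ℝ} (hq : IsLogConcaveSeq q) : IsNLC (fun S : Finset σ => q S.card) := by
  intro S T
  dsimp only
  rw [mul_comm (q (S ∪ T).card)]
  exact hq.2 (Finset.card_le_card Finset.inter_subset_left) (Finset.card_le_card Finset.subset_union_left)
    (Finset.card_inter_add_card_union S T)

/-- NLC ⟹ ULC: an NLC nonnegative weight `μ(S) = q(|S|)` has a `PF₂` profile (the one vanishing above `n`; the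
interval inequality `q(a)q(d) ≤ q(b)q(c)` is NLC for nested sets `A ⊆ B ⊆ D` of these sizes and
`T = A ∪ (D ∖ B)`). [cite: Pemantle2000, §2.4 Thm. 2.7 ("trivially equivalent to the negative lattice condition")] -/
theorem exists_isLogConcaveSeq_of_isNLC {μ : Finset σ → ℝ} {q : ℕ → ℝ} (hμ : ∀ S, μ S = q S.card)
    (h0 : ∀ S, 0 ≤ μ S) (h : IsNLC μ) :
    ∃ q' : ℕ → ℝ, IsLogConcaveSeq q' ∧ ∀ S, μ S = q' S.card := by
  have hq0 : ∀ k, k ≤ Fintype.card σ → 0 ≤ q k := fun k hk => by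
    obtain ⟨S, -, hS⟩ := Finset.exists_subset_card_eq (s := (Finset.univ : Finset σ)) (n := k)
      (by rw [Finset.card_univ]; exact hk)
    rw [← hS, ← hμ]; exact h0 S
  have hq0' : ∀ k, 0 ≤ (if k ≤ Fintype.card σ then q k else 0) := fun k => by
    split_ifs with hk
    · exact hq0 k hk
    · exact le_rfl
  refine ⟨fun k => if k ≤ Fintype.card σ then q k else 0, ⟨hq0', fun a b c d hab hbd habcd => ?_⟩, fun S => ?_⟩
  · by_cases hd : d ≤ Fintype.card σ
    · have ha : a ≤ Fintype.card σ := by omega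
      have hb : b ≤ Fintype.card σ := by omega
      have hc : c ≤ Fintype.card σ := by omega
      dsimp only
      rw [if_pos ha, if_pos hb, if_pos hc, if_pos hd]
      -- nested sets `A ⊆ B ⊆ D ⊆ univ` with `|A| = a`, `|B| = b`, `|D| = d`
      obtain ⟨D, -, hD⟩ := Finset.exists_subset_card_eq (s := (Finset.univ : Finset σ)) (n := d)
        (by rw [Finset.card_univ]; exact hd)
      obtain ⟨B, hBD, hB⟩ := Finset.exists_subset_card_eq (s := D) (n := b) (by omega)
      obtain ⟨A, hAB, hA⟩ := Finset.exists_subset_card_eq (s := B) (n := a) (by omega)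
      have key := h B (A ∪ D \ B)
      have hU : B ∪ (A ∪ D \ B) = D := by
        ext x
        simp only [Finset.mem_union, Finset.mem_sdiff]
        constructor
        · rintro (hx | hx | ⟨hx, _⟩)
          · exact hBD hx
          · exact hBD (hAB hx)
          · exact hx
        · intro hx
          by_cases hxB : x ∈ B
          · exact Or.inl hxB
          · exact Or.inr (Or.inr ⟨hx, hxB⟩)
      have hI : B ∩ (A ∪ D \ B) = A := by
        ext x
        simp only [Finset.mem_inter, Finset.mem_union, Finset.mem_sdiff]
        constructor
        · rintro ⟨hxB, hx | ⟨_, hxB'⟩⟩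
          · exact hx
          · exact absurd hxB hxB'
        · exact fun hx => ⟨hAB hx, Or.inl hx⟩
      have hT : (A ∪ D \ B).card = c := by
        rw [Finset.card_union_of_disjoint (Finset.disjoint_left.2 fun x hxA hx => (Finset.mem_sdiff.1 hx).2 (hAB hxA)),
          Finset.card_sdiff_of_subset hBD, hA, hB, hD]
        omega
      rw [hU, hI, hμ, hμ, hμ, hμ, hD, hA, hB, hT, mul_comm (q d)] at key
      exact key
    · have : (if d ≤ Fintype.card σ then q d else 0) = 0 := if_neg hd
      dsimp only
      rw [this, mul_zero]
      exact mul_nonneg (hq0' b) (hq0' c)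
  · dsimp only
    rw [if_pos (by rw [← Finset.card_univ]; exact Finset.card_le_card (Finset.subset_univ S))]
    exact hμ S

/-- **"ULC is trivially equivalent to the negative lattice condition"** for exchangeable nonnegative weights.
[cite: Pemantle2000, §2.4 Thm. 2.7] -/
theorem IsExchangeable.isNLC_iff {μ : Finset σ → ℝ} (hex : IsExchangeable μ) (h0 : ∀ S, 0 ≤ μ S) :
    IsNLC μ ↔ ∃ q : ℕ → ℝ, IsLogConcaveSeq q ∧ ∀ S, μ S = q S.card := by
  constructor
  · intro h
    obtain ⟨b, hb⟩ := hex.exists_eq_card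
    exact exists_isLogConcaveSeq_of_isNLC (fun S => by rw [hb]) h0 h
  · rintro ⟨q, hq, hμ⟩
    rw [show μ = fun S => q S.card from funext hμ]
    exact isNLC_card hq

omit [DecidableEq σ] in
/-- ULC of the rank sequence in Brändén–Huh's normalized form: for `μ(S) = q(|S|)` with `q` `PF₂`, the rank
sequence `r_k = C(n,k) q(k)` has `r_{k-1} r_{k+1}/(C(n,k-1)C(n,k+1)) ≤ r_k²/C(n,k)²`.
[cite: Pemantle2000, §2.4 Def. 2.6; BrandenHuh2019, §2.4 Example 2.26] -/
theorem isUltraLogConcave_rankSeq_card {q : ℕ → ℝ} (hq : IsLogConcaveSeq q) :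
    IsUltraLogConcave (Fintype.card σ) (rankSeq (fun S : Finset σ => q S.card)) := by
  intro k hk hkn
  rw [rankSeq_card, rankSeq_card, rankSeq_card]
  have hc : ∀ j, j ≤ Fintype.card σ → ((Fintype.card σ).choose j : ℝ) ≠ 0 := fun j hj => by
    exact_mod_cast (Nat.choose_pos hj).ne'
  rw [mul_div_cancel_left₀ _ (hc _ (by omega)), mul_div_cancel_left₀ _ (hc _ (by omega)),
    mul_div_cancel_left₀ _ (hc _ hkn.le), sq]
  exact hq.2 (by omega) (by omega) (by omega)

end NLC

/-! ## §3 Lemma 2.8 for a block of coordinates: external field, then projection -/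

section Lemma28

/-- The sets with prescribed trace on `S` are `T ∪ W`, `W ⊆ Sᶜ`: reindexing a sum. [cite: Pemantle2000, §2.4
Lemma 2.8 ("imposing an external field at coordinates `1,…,k` and then projecting onto coordinates `r+1,…,n`")] -/
theorem sum_ite_inter_eq (S T : Finset σ) (hT : T ⊆ S) (F : Finset σ → ℝ) :
    (∑ U : Finset σ, if U ∩ S = T then F U else 0) = ∑ W ∈ Sᶜ.powerset, F (T ∪ W) := by
  rw [← Finset.sum_filter]
  refine Finset.sum_bij' (fun U _ => U \ S) (fun W _ => T ∪ W) (fun U hU => ?_) (fun W hW => ?_)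
    (fun U hU => ?_) (fun W hW => ?_) (fun U hU => ?_)
  · rw [Finset.mem_powerset]
    intro x hx
    rw [Finset.mem_compl]
    exact (Finset.mem_sdiff.1 hx).2
  · rw [Finset.mem_powerset] at hW
    rw [Finset.mem_filter]
    refine ⟨Finset.mem_univ _, ?_⟩
    rw [Finset.union_inter_distrib_right, Finset.inter_eq_left.2 hT]
    have : W ∩ S = ∅ := Finset.disjoint_iff_inter_eq_empty.1
      (Finset.disjoint_left.2 fun x hx hxS => Finset.mem_compl.1 (hW hx) hxS)
    rw [this, Finset.union_empty]
  · have hU' := (Finset.mem_filter.1 hU).2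
    ext x
    simp only [Finset.mem_union, Finset.mem_sdiff]
    constructor
    · rintro (hx | ⟨hx, _⟩)
      · rw [← hU'] at hx; exact (Finset.mem_inter.1 hx).1
      · exact hx
    · intro hx
      by_cases hxS : x ∈ S
      · left; rw [← hU']; exact Finset.mem_inter.2 ⟨hx, hxS⟩
      · right; exact ⟨hx, hxS⟩
  · rw [Finset.mem_powerset] at hW
    ext x
    simp only [Finset.mem_sdiff, Finset.mem_union]
    constructor
    · rintro ⟨hx | hx, hxS⟩
      · exact absurd (hT hx) hxS
      · exact hx
    · exact fun hx => ⟨Or.inr hx, Finset.mem_compl.1 (hW hx)⟩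
  · have hU' := (Finset.mem_filter.1 hU).2
    congr 1
    ext x
    simp only [Finset.mem_union, Finset.mem_sdiff]
    constructor
    · intro hx
      by_cases hxS : x ∈ S
      · left; rw [← hU']; exact Finset.mem_inter.2 ⟨hx, hxS⟩
      · right; exact ⟨hx, hxS⟩
    · rintro (hx | ⟨hx, _⟩)
      · rw [← hU'] at hx; exact (Finset.mem_inter.1 hx).1
      · exact hx

/-- **The profile after an external field on `Sᶜ` and projection onto `S`**: for `μ(U) = q(|U|)`,
`(projectOn S (extField a μ))(T) = a^T · Σ_{W ⊆ Sᶜ} a^W q(|T| + |W|)` for `T ⊆ S`. [cite: Pemantle2000, §2.4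
Lemma 2.8 ("`q_j' = C(q_j + λ q_{j+1})`")] -/
theorem projectOn_extField_card {q : ℕ → ℝ} (a : σ → ℝ) (S T : Finset σ) (hT : T ⊆ S) :
    projectOn S (extField a (fun U : Finset σ => q U.card)) T =
      (∏ i ∈ T, a i) * ∑ W ∈ Sᶜ.powerset, (∏ i ∈ W, a i) * q (T.card + W.card) := by
  rw [projectOn_apply]
  simp only [extField_apply]
  rw [sum_ite_inter_eq S T hT, Finset.mul_sum]
  refine Finset.sum_congr rfl fun W hW => ?_
  rw [Finset.mem_powerset] at hW
  have hdisj : Disjoint T W := Finset.disjoint_left.2 fun x hxT hxW => Finset.mem_compl.1 (hW hxW) (hT hxT)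
  rw [Finset.card_union_of_disjoint hdisj, Finset.prod_union hdisj]
  ring

omit [Fintype σ] in
/-- **Lemma 2.8, iterated over the block `R`**: `Q_R(j) = Σ_{W ⊆ R} a^W q(j + |W|)` is `PF₂` whenever `q` is and
`a ≥ 0` (one coordinate at a time: `Q_{R ∪ {e}}(j) = Q_R(j) + a_e Q_R(j+1)`). [cite: Pemantle2000, §2.4 Lemma 2.8
("it suffices to consider the case `r = 1` … by induction on `j`")] -/
theorem isLogConcaveSeq_fieldSum {q : ℕ → ℝ} (hq : IsLogConcaveSeq q) {a : σ → ℝ} (ha : ∀ i, 0 ≤ a i)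
    (R : Finset σ) : IsLogConcaveSeq fun j => ∑ W ∈ R.powerset, (∏ i ∈ W, a i) * q (j + W.card) := by
  induction R using Finset.induction_on with
  | empty =>
    have : (fun j => ∑ W ∈ (∅ : Finset σ).powerset, (∏ i ∈ W, a i) * q (j + W.card)) = q := by
      funext j
      rw [Finset.powerset_empty, Finset.sum_singleton, Finset.prod_empty, Finset.card_empty, one_mul, add_zero]
    rw [this]
    exact hq
  | @insert e R he ih =>
    have hsplit : (fun j => ∑ W ∈ (insert e R).powerset, (∏ i ∈ W, a i) * q (j + W.card)) =
        fun j => (∑ W ∈ R.powerset, (∏ i ∈ W, a i) * q (j + W.card)) +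
          a e * ∑ W ∈ R.powerset, (∏ i ∈ W, a i) * q (j + 1 + W.card) := by
      funext j
      rw [Finset.powerset_insert, Finset.sum_union, Finset.sum_image, Finset.mul_sum]
      · congr 1
        refine Finset.sum_congr rfl fun W hW => ?_
        have heW : e ∉ W := fun h' => he (Finset.mem_powerset.1 hW h')
        rw [Finset.prod_insert heW, Finset.card_insert_of_notMem heW]
        ring_nf
      · intro W hW W' hW' hWW'
        have heW : e ∉ W := fun h' => he (Finset.mem_powerset.1 (Finset.mem_coe.1 hW) h')
        have heW' : e ∉ W' := fun h' => he (Finset.mem_powerset.1 (Finset.mem_coe.1 hW') h')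
        rw [← Finset.erase_insert heW, hWW', Finset.erase_insert heW']
      · rw [Finset.disjoint_left]
        intro W hW hW'
        obtain ⟨W', hW'R, hWW'⟩ := Finset.mem_image.1 hW'
        have : e ∈ W := by rw [← hWW']; exact Finset.mem_insert_self e W'
        exact he (Finset.mem_powerset.1 hW this)
    rw [hsplit]
    exact IsLogConcaveSeq.add_mul_succ ih (ha e)

end Lemma28

/-! ## §4 Theorem 2.7: ULC ⟹ h-NLC+, and the equivalences -/

section Theorem27

/-- **Pemantle, Thm. 2.7 (ULC ⟹ h-NLC+)**: an exchangeable weight `μ(S) = q(|S|)` with `PF₂` profile is h-NLC+ —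
after an external field `a` and projection onto `S` the weight is `T ↦ a^T Q(|T|)` with `Q` `PF₂` (Lemma 2.8),
and NLC "is invariant under external fields". [cite: Pemantle2000, §2.4 Thm. 2.7 (proof, first paragraph),
Lemma 2.8] -/
theorem isHNLCPlus_card {q : ℕ → ℝ} (hq : IsLogConcaveSeq q) : IsHNLCPlus (fun S : Finset σ => q S.card) := by
  intro a ha S T₁ T₂
  have hQ := isLogConcaveSeq_fieldSum hq ha Sᶜ
  set Q : ℕ → ℝ := fun j => ∑ W ∈ Sᶜ.powerset, (∏ i ∈ W, a i) * q (j + W.card) with hQdef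
  have hν0 : ∀ T, 0 ≤ projectOn S (extField a (fun U : Finset σ => q U.card)) T :=
    projectOn_nonneg (extField_nonneg (fun U => hq.1 _) ha) S
  by_cases h₁ : T₁ ⊆ S
  · by_cases h₂ : T₂ ⊆ S
    · have hU : T₁ ∪ T₂ ⊆ S := Finset.union_subset h₁ h₂
      have hI : T₁ ∩ T₂ ⊆ S := Finset.inter_subset_left.trans h₁
      rw [projectOn_extField_card a S _ hU, projectOn_extField_card a S _ hI, projectOn_extField_card a S _ h₁,
        projectOn_extField_card a S _ h₂]
      have key : Q (T₁ ∪ T₂).card * Q (T₁ ∩ T₂).card ≤ Q T₁.card * Q T₂.card := by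
        rw [mul_comm]
        exact hQ.2 (Finset.card_le_card Finset.inter_subset_left) (Finset.card_le_card Finset.subset_union_left)
          (Finset.card_inter_add_card_union T₁ T₂)
      have hprod : (∏ i ∈ T₁ ∪ T₂, a i) * ∏ i ∈ T₁ ∩ T₂, a i = (∏ i ∈ T₁, a i) * ∏ i ∈ T₂, a i :=
        Finset.prod_union_inter
      have hP : 0 ≤ (∏ i ∈ T₁, a i) * ∏ i ∈ T₂, a i :=
        mul_nonneg (Finset.prod_nonneg fun i _ => ha i) (Finset.prod_nonneg fun i _ => ha i)
      calc (∏ i ∈ T₁ ∪ T₂, a i) * Q (T₁ ∪ T₂).card * ((∏ i ∈ T₁ ∩ T₂, a i) * Q (T₁ ∩ T₂).card)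
          = ((∏ i ∈ T₁, a i) * ∏ i ∈ T₂, a i) * (Q (T₁ ∪ T₂).card * Q (T₁ ∩ T₂).card) := by
            rw [← hprod]; ring
        _ ≤ ((∏ i ∈ T₁, a i) * ∏ i ∈ T₂, a i) * (Q T₁.card * Q T₂.card) := mul_le_mul_of_nonneg_left key hP
        _ = (∏ i ∈ T₁, a i) * Q T₁.card * ((∏ i ∈ T₂, a i) * Q T₂.card) := by ring
    · rw [projectOn_eq_zero_of_not_subset _ (fun h' => h₂ (Finset.subset_union_right.trans h')), zero_mul]
      exact mul_nonneg (hν0 _) (hν0 _)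
  · rw [projectOn_eq_zero_of_not_subset _ (fun h' => h₁ (Finset.subset_union_left.trans h')), zero_mul]
    exact mul_nonneg (hν0 _) (hν0 _)

/-- **Thm. 2.7 with Prop. 2.2: ULC exchangeable weights are Rayleigh** (Wagner Prop. 3.6 (b)⟹(a):
`Σ_k a_k e_k(y)` with `(a_k)` log-concave without internal zeros satisfies the Rayleigh condition).
[cite: Pemantle2000, §2.4 Thm. 2.7; Wagner2008, §3 Prop. 3.6; BorceaBrandenLiggett2007, §2.1 Prop. 2.2] -/
theorem isRayleigh_card {q : ℕ → ℝ} (hq : IsLogConcaveSeq q) : IsRayleigh (fun S : Finset σ => q S.card) :=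
  isRayleigh_of_isHNLCPlus (isHNLCPlus_card hq)

/-- **Wagner, Prop. 3.6 (a)⟺(b) / Pemantle Thm. 2.7 (Rayleigh form)**: an exchangeable nonnegative weight is
Rayleigh iff its profile `q` (`μ(S) = q(|S|)`) can be taken log-concave with no internal zeros.
[cite: Wagner2008, §3 Prop. 3.6; Pemantle2000, §2.4 Thm. 2.7] -/
theorem IsExchangeable.isRayleigh_iff {μ : Finset σ → ℝ} (hex : IsExchangeable μ) (h0 : ∀ S, 0 ≤ μ S) :
    IsRayleigh μ ↔ ∃ q : ℕ → ℝ, IsLogConcaveSeq q ∧ ∀ S, μ S = q S.card := by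
  rw [← hex.isNLC_iff h0]
  refine ⟨fun h => h.isNLC h0, fun h => ?_⟩
  obtain ⟨q, hq, hμ⟩ := (hex.isNLC_iff h0).1 h
  rw [show μ = fun S => q S.card from funext hμ]
  exact isRayleigh_card hq

/-- **Thm. 2.7: for exchangeable weights, h-NLC+ ⟺ ULC.** [cite: Pemantle2000, §2.4 Thm. 2.7] -/
theorem IsExchangeable.isHNLCPlus_iff {μ : Finset σ → ℝ} (hex : IsExchangeable μ) (h0 : ∀ S, 0 ≤ μ S) :
    IsHNLCPlus μ ↔ ∃ q : ℕ → ℝ, IsLogConcaveSeq q ∧ ∀ S, μ S = q S.card := by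
  rw [← isRayleigh_iff_isHNLCPlus h0]
  exact hex.isRayleigh_iff h0

omit [Fintype σ] [DecidableEq σ] in
/-- `extField 1` is the identity. [cite: BorceaBrandenLiggett2007, §2.1 (iv)] -/
theorem extField_one (μ : Finset σ → ℝ) : extField (fun _ => (1 : ℝ)) μ = μ := by
  funext S
  rw [extField_apply, Finset.prod_const_one, mul_one]

/-- h-NLC+ gives h-NLC (the trivial external field). [cite: BorceaBrandenLiggett2007, §2.1 Def. 2.4] -/
theorem IsHNLCPlus.isHNLC {μ : Finset σ → ℝ} (h : IsHNLCPlus μ) : IsHNLC μ := by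
  have := h (fun _ => 1) (fun _ => zero_le_one)
  rwa [extField_one] at this

/-- **Thm. 2.7: for exchangeable weights, h-NLC ⟺ ULC** (h-NLC ⟹ NLC ⟹ ULC ⟹ h-NLC+ ⟹ h-NLC).
[cite: Pemantle2000, §2.4 Thm. 2.7] -/
theorem IsExchangeable.isHNLC_iff {μ : Finset σ → ℝ} (hex : IsExchangeable μ) (h0 : ∀ S, 0 ≤ μ S) :
    IsHNLC μ ↔ ∃ q : ℕ → ℝ, IsLogConcaveSeq q ∧ ∀ S, μ S = q S.card :=
  ⟨fun h => (hex.isNLC_iff h0).1 h.isNLC, fun h => ((hex.isHNLCPlus_iff h0).2 h).isHNLC⟩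

/-- **ULC of the rank sequence of an exchangeable Rayleigh measure** (Wagner Prop. 3.6 (a)⟹(b) in Brändén–Huh's
normalization). [cite: Wagner2008, §3 Prop. 3.6; Pemantle2000, §2.4 Thm. 2.7] -/
theorem IsExchangeable.isUltraLogConcave_rankSeq {μ : Finset σ → ℝ} (hex : IsExchangeable μ) (h0 : ∀ S, 0 ≤ μ S)
    (h : IsRayleigh μ) : IsUltraLogConcave (Fintype.card σ) (rankSeq μ) := by
  obtain ⟨q, hq, hμ⟩ := (hex.isRayleigh_iff h0).1 h
  rw [show μ = fun S => q S.card from funext hμ]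
  exact isUltraLogConcave_rankSeq_card hq

end Theorem27

/-! ## Uniform matroids are correlated (Semple–Welsh 2008, Example 2.2)

C. Semple, D. Welsh, *Negative correlation in graphs and matroids* [SempleWelsh2008], §2 (verbatim, p. 4): "A matroid
is *independence correlated* if, for all distinct `e, f ∈ E` and positive real-valued weightings `y` of `E`,
`ΔI(M; y) = I_e(M; y) I_f(M; y) - I_{ef}(M; y) I(M; y) ≥ 0`. A matroid is *spanning correlated* if […]
`ΔS(M; y) = S_e(M; y) S_f(M; y) - S_{ef}(M; y) S(M; y) ≥ 0`. We say a matroid is *correlated* if it is both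
independence correlated and spanning correlated. […] **Example 2.2. Uniform matroids are correlated.**" Here
`I(M; y) = Σ_{A independent} y^A`, `I_e = Σ_{A ∋ e}`, etc., so "independence correlated" is exactly `IsRayleigh` of
the indicator weight of the independent sets (`I_e I_f - I_{ef} I = y_e y_f Δ_{ef}(I)(y)`), and for `U_{r,n}` the
three weights (independent sets `|S| ≤ r`, spanning sets `|S| ≥ r`, bases `|S| = r`) are exchangeable with `PF₂`
profiles, whence Rayleigh by `isRayleigh_card` (Semple–Welsh argue instead with Newton-type inequalities for the
elementary symmetric functions of `y_1, …, y_{n-2}`). -/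

section UniformMatroids

/-- The constant sequence `1` is `PF₂`. [cite: Karlin1968, Ch. 8 §1] -/
theorem isLogConcaveSeq_one : IsLogConcaveSeq fun _ : ℕ => (1 : ℝ) :=
  ⟨fun _ => zero_le_one, fun _ _ _ _ _ _ _ => le_rfl⟩

/-- **`U_{r,n}` is independence correlated**: the independent-set weight `1_{|S| ≤ r}` is Rayleigh.
[cite: SempleWelsh2008, §2 Example 2.2] -/
theorem isRayleigh_uniformMatroid_indep (r : ℕ) : IsRayleigh (fun S : Finset σ => if S.card ≤ r then (1 : ℝ) else 0) := by
  have h : IsLogConcaveSeq fun n : ℕ => if n ≤ r then (1 : ℝ) else 0 := isLogConcaveSeq_one.truncLE r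
  exact isRayleigh_card (σ := σ) (q := fun n : ℕ => if n ≤ r then (1 : ℝ) else 0) h

/-- **`U_{r,n}` is spanning correlated**: the spanning-set weight `1_{r ≤ |S|}` is Rayleigh.
[cite: SempleWelsh2008, §2 Example 2.2] -/
theorem isRayleigh_uniformMatroid_spanning (r : ℕ) :
    IsRayleigh (fun S : Finset σ => if r ≤ S.card then (1 : ℝ) else 0) := by
  have h : IsLogConcaveSeq fun n : ℕ => if r ≤ n then (1 : ℝ) else 0 := isLogConcaveSeq_one.truncGE r
  exact isRayleigh_card (σ := σ) (q := fun n : ℕ => if r ≤ n then (1 : ℝ) else 0) h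

/-- **The bases of `U_{r,n}` are Rayleigh** (`1_{|S| = r}`; the basis generating polynomial is `e_r`).
[cite: SempleWelsh2008, §2 Example 2.2, §1 (Rayleigh matroids)] -/
theorem isRayleigh_uniformMatroid_bases (r : ℕ) : IsRayleigh (fun S : Finset σ => if S.card = r then (1 : ℝ) else 0) := by
  have h := (isLogConcaveSeq_one.truncLE r).truncGE r
  have heq : (fun n : ℕ => if r ≤ n then (if n ≤ r then (1 : ℝ) else 0) else 0) = fun n => if n = r then 1 else 0 :=
    funext fun n => by
      by_cases hn : n = r
      · subst hn; simp
      · rw [if_neg hn]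
        by_cases h1 : r ≤ n
        · rw [if_pos h1, if_neg (fun h2 => hn (le_antisymm h2 h1))]
        · rw [if_neg h1]
  rw [heq] at h
  exact isRayleigh_card (σ := σ) (q := fun n : ℕ => if n = r then (1 : ℝ) else 0) h

/-- **Semple–Welsh, Example 2.2: uniform matroids are correlated** (independence correlated, spanning correlated,
and Rayleigh). [cite: SempleWelsh2008, §2 Example 2.2] -/
theorem SempleWelsh2008_example_2_2 (r : ℕ) :
    IsRayleigh (fun S : Finset σ => if S.card ≤ r then (1 : ℝ) else 0) ∧
      IsRayleigh (fun S : Finset σ => if r ≤ S.card then (1 : ℝ) else 0) ∧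
        IsRayleigh (fun S : Finset σ => if S.card = r then (1 : ℝ) else 0) :=
  ⟨isRayleigh_uniformMatroid_indep r, isRayleigh_uniformMatroid_spanning r, isRayleigh_uniformMatroid_bases r⟩

/-- The independent sets of `U_{r,n}` are moreover h-NLC+ ∕ NLC (Prop. 2.2). [cite: SempleWelsh2008, §2 Example 2.2;
BorceaBrandenLiggett2007, §2.1 Prop. 2.2] -/
theorem isHNLCPlus_uniformMatroid_indep (r : ℕ) :
    IsHNLCPlus (fun S : Finset σ => if S.card ≤ r then (1 : ℝ) else 0) :=
  (isRayleigh_uniformMatroid_indep r).isHNLCPlus fun S => by split_ifs <;> norm_num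

end UniformMatroids

end Literature.Probability.NegativeDependence

end
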